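import Literature.Geometry.Kaehler.ComplexTorusSiegelNormalForm
import Literature.Geometry.Kaehler.ComplexTorusFrobeniusBasis
import HarnessLib

/-!
# Every polarised complex torus is a Siegel torus `ℂ^g/(Dℤ^g ⊕ Ωℤ^g)` (reduction to the period matrix `(D, Ω)`)

For a complex torus `X = E/Φ(ℤ^ι)` (`ComplexTorus Φ`, `Literature/Geometry/Kaehler/ComplexTorus.lean`)
which is an abelian variety in the sense of `ComplexTorus.IsAbelianVariety Φ` (it admits a Riemann
form, `ComplexTorusSubvarieties.lean`), Lange–Birkenhake, *Complex Abelian Varieties*, §3.1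
(Frobenius: a symplectic basis of type `D = diag(d₁, …, d_g)` of the lattice for the alternating
form of the polarization) and §8.1 Prop. 8.1.1 (in such a basis the period matrix is `(Z, D)` with
`Z` in the Siegel upper half space `𝔥_g`) give:

* `ComplexTorus.IsAbelianVariety.exists_siegelTorus` — there are `g`, a type `d : Fin g → ℕ`
  (`dᵢ ≥ 1`, `d₁ | d₂ | ⋯ | d_g`), a symmetric `Ω ∈ M_g(ℂ)` with `Im Ω` positive definite, the Siegel
  period isomorphism `Φ' : ℝ^g ⊕ ℝ^g ≃ ℂ^g`, `(x, y) ↦ Dx + Ωy` (so that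
  `ComplexTorus Φ' = ℂ^g/(Dℤ^g ⊕ Ωℤ^g)`), and an additive homeomorphism
  `e : X ≃ₜ ComplexTorus Φ'` (a `mapMatrix` of a unimodular base change, with `mapMatrix` inverse)
  holomorphic in both directions; moreover `dim_ℂ E = g`, and every `ℂ`-scheme analytified by the
  Siegel torus is analytified by `X` through `e`.

It is the composition of `ComplexTorus.IsRiemannForm.exists_symplecticBasis_typeD`
(`ComplexTorusFrobeniusBasis.lean`: the Frobenius basis with its halves exchanged, so that the type
sits on `ω(Φ b₂ᵢ, Φ b₁ⱼ) = dᵢ δᵢⱼ` in the tree's convention `ω(iu, u) > 0`) with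
`ComplexTorus.exists_siegelTorus_typeD` (`ComplexTorusSiegelNormalForm.lean`).
With Lefschetz's theorem for `ℂ^g/(Dℤ^g ⊕ Ωℤ^g)` (theta functions of type `D`) it yields that every
polarised complex torus is the analytification of a smooth projective variety (Lange–Birkenhake
§4.1, Thm. 4.5.1; Huybrechts, *Complex Geometry*, Cor. 5.3.5) — assembled on the `Summits` side.
Everything here is a theorem; no definition, no named fact.

## References

* [LangeBirkenhake1992] H. Lange, Ch. Birkenhake, *Complex Abelian Varieties*, Grundlehren 302
  (1992), §1.1.2, §3.1, §8.1 Prop. 8.1.1.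
-/

noncomputable section

open scoped Manifold ContDiff
open Module

namespace Literature.Geometry.Kaehler

namespace ComplexTorus

open Literature.NumberTheory.Transcendental (IsAnalytification)
open Literature.AlgebraicGeometry.Motives (SchemeOver ComplexPoints)

variable {ι : Type*} [Fintype ι] [DecidableEq ι] {E : Type*} [NormedAddCommGroup E] [NormedSpace ℂ E]

/-- **Every polarised complex torus is biholomorphic to a Siegel torus of type `D`.** If
`X = E/Φ(ℤ^ι)` admits a Riemann form, then for some `g`, a type `d` (`dᵢ ≥ 1`, `d₁ | ⋯ | d_g`) and a
symmetric `Ω` with `Im Ω` positive definite, the Siegel period isomorphism `Φ'(x, y) = Dx + Ωy`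
presents a torus `ℂ^g/(Dℤ^g ⊕ Ωℤ^g)` and there is an additive homeomorphism
`e : X ≃ₜ ℂ^g/(Dℤ^g ⊕ Ωℤ^g)`, holomorphic with holomorphic inverse (both `mapMatrix` of unimodular
integer matrices); `dim_ℂ E = g`; and analytifications by the Siegel torus transport to `X` along
`e` (Lange–Birkenhake §3.1 with §8.1 Prop. 8.1.1: "`X ≅ ℂ^g/(Z, D)ℤ^{2g}`, `Z ∈ 𝔥_g`").
[cite: LangeBirkenhake1992, §8.1 Prop. 8.1.1] [cite: LangeBirkenhake1992, §3.1] -/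
theorem IsAbelianVariety.exists_siegelTorus [FiniteDimensional ℂ E] {Φ : (ι → ℝ) ≃L[ℝ] E}
    (hX : IsAbelianVariety Φ) :
    ∃ (g : ℕ) (d : Fin g → ℕ) (Ω : Matrix (Fin g) (Fin g) ℂ)
      (Φ' : (Fin g ⊕ Fin g → ℝ) ≃L[ℝ] (Fin g → ℂ)) (e : ComplexTorus Φ ≃ₜ ComplexTorus Φ'),
      (∀ i, 0 < d i) ∧ (∀ i j, i ≤ j → d i ∣ d j) ∧
      (∀ i j, Ω i j = Ω j i) ∧
      (Matrix.of fun i j => (Ω i j).im).PosDef ∧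
      (∀ v i, Φ' v i = (d i : ℂ) * (v (Sum.inl i) : ℂ) + ∑ j, Ω i j * (v (Sum.inr j) : ℂ)) ∧
      (∃ P : Matrix (Fin g ⊕ Fin g) ι ℤ, ∃ Q : Matrix ι (Fin g ⊕ Fin g) ℤ,
        P * Q = 1 ∧ Q * P = 1 ∧ (∀ x, e x = mapMatrix Φ Φ' P x) ∧
          ∀ y, e.symm y = mapMatrix Φ' Φ Q y) ∧
      (∀ x y, e (x + y) = e x + e y) ∧
      ContMDiff 𝓘(ℂ, E) 𝓘(ℂ, Fin g → ℂ) ω e ∧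
      ContMDiff 𝓘(ℂ, Fin g → ℂ) 𝓘(ℂ, E) ω e.symm ∧
      finrank ℂ E = g ∧
      ∀ (X : SchemeOver ℂ) (φ : ComplexTorus Φ' → ComplexPoints X),
        IsAnalytification (Fin g → ℂ) X g φ → IsAnalytification E X g (φ ∘ e) := by
  obtain ⟨η, hη⟩ := hX
  obtain ⟨g, b, d, hd, hdvd, h₁₁, h₂₂, h₂₁⟩ := hη.exists_symplecticBasis_typeD
  obtain ⟨Ω, Φ', e, hΩsym, hΩpos, hΦ'v, he, hesymm, headd, hhol, hholsymm, hdim, htr⟩ :=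
    exists_siegelTorus_typeD Φ hη b d hd h₁₁ h₂₂ h₂₁
  exact ⟨g, d, Ω, Φ', e, hd, hdvd, hΩsym, hΩpos, hΦ'v,
    ⟨b.toMatrix (Pi.basisFun ℤ ι), (Pi.basisFun ℤ ι).toMatrix b,
      b.toMatrix_mul_toMatrix_flip (Pi.basisFun ℤ ι), (Pi.basisFun ℤ ι).toMatrix_mul_toMatrix_flip b,
      he, hesymm⟩,
    headd, hhol, hholsymm, hdim, htr⟩

end ComplexTorus

end Literature.Geometry.Kaehler

end
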